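import Mathlib
import HarnessLib
import Literature.Probability.LatticeModels.SubmultiplicativeTreeWeight
import Literature.MathematicalPhysics.QuantumLattice.TorusLabelDistance
import Summits.HubbardSuperconductivity.HubbardSuperconductivity.Theorems.KLProgrammeKLRegimeTwoVolumeSpectatorLegs

/-!
# Route `KLProgramme` — crux K3, the nested two-volume pass on the DOUBLED (source-carrying) labels `Γ × Fin 2`: the STRUCTURAL DATA of
# `…TwoVolumeScaleSucc.twoVolume_scale_succ_le` lifted from the alive labels (cell gate-hubbard-kl, seat hubbard-kl-k3c4-p1 g11; `--supports` stmt-…-20440)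

The augmented (source-carrying) organisation of the VL child's two-volume induction (VL-INDUCTION-BLUEPRINT-g10 §A/§C) runs the generic one-scale lemma
`twoVolume_scale_succ_le` on the doubled label types `Γ × Fin 2` (copy `0` = alive sector fields, copy `1` = plain source legs; k3c5-p3's convention of
`…TwoVolumeSpectatorLegs`), with the SPECTATOR covariances `C⁺((X,s),(Y,s′)) = [s = s′ = 0]·C(X,Y)` and the copy-by-copy block substitutions
`T⁺ = T ⊕ J` of `…TwoVolumeDoubledTowerStep`.  Every structural hypothesis of the one-scale lemma for the doubled data is the corresponding hypothesis
for the alive data; this file records the lifts, all in the tree's property form (`hC⁺ : ∀ p q, C⁺ p q = if p.2 = 0 ∧ q.2 = 0 then C p.1 q.1 else 0`,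
`hT⁺ : ∀ p′ p, T⁺ p′ p = if p′.2 = 0 ∧ p.2 = 0 then T p′.1 p.1 else if p′.2 = 1 ∧ p.2 = 1 then J p′.1 p.1 else 0`):

* §1 the doubled block structure `exists_doubledEquiv` (`(Γ′ × Fin 2) ≃ ι × (Γ × Fin 2)` over `e : Γ′ ≃ ι × Γ`, with its forward and inverse formulas);
  pulled-back distances: `labelDiam_comap_image`, `diamWeight_comap_eq`;
* §2 spectator covariances: periodisation `(P)` (`spectatorCov_periodise`), block copies (`spectatorCov_copies`), the near / far defects against the lifted
  zone `{p | p.1 ∈ Zs}` (`spectatorCov_nearDefect`, `spectatorCov_farDefect`), interpolated families (`spectatorCov_smul`, `spectatorCov_add_smul`) hence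
  their replica-Gram constants (`isGramBoundedR_spectator_smul`, `isGramBoundedR_spectator_add_smul`), and the master formula for filtered weighted row /
  column sums (`sum_filter_norm_spectatorCov_mul_row/_col`, `…_le`) from which the decay numbers, tails and first moments of the one-scale lemma follow;
* the block substitutions `T⁺ = T ⊕ J` (periodisation `(P_T)`, filtered sums) are the companion file `…TwoVolumeDoubledBlockData`.

Everything is proved; no definition; model-free.  References: BGM 2006 §2.9 (4.3)–(4.8) (the external-field sector rides the same trees); Salmhofer 1999 §4.3.
-/

noncomputable section

namespace Summit.HubbardSuperconductivity.HubbardSuperconductivity.Theorems.TwoVolumeDefect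

set_option linter.dupNamespace false -- summit = problem name (single-conjunct summit), D-0017

open Finset Literature.MathematicalPhysics.QuantumLattice GrassmannAlgebra Literature.Probability.LatticeModels
  Literature.Probability.LatticeModels.BattleFederbush

universe u

/-! ## §1 The doubled block structure and pulled-back distances -/

section Blocks

variable {ι Γ Γ' : Type*}

/-- **The doubled block structure**: over `e : Γ′ ≃ ι × Γ` there is `e⁺ : (Γ′ × Fin 2) ≃ ι × (Γ × Fin 2)` with `e⁺ (x, s) = ((e x).1, ((e x).2, s))` and
`e⁺⁻¹ (β, (y, s)) = (e⁻¹ (β, y), s)` (same block, same copy). [folklore] -/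
theorem exists_doubledEquiv (e : Γ' ≃ ι × Γ) :
    ∃ ed : (Γ' × Fin 2) ≃ ι × (Γ × Fin 2), (∀ x s, ed (x, s) = ((e x).1, ((e x).2, s))) ∧
      ∀ β y s, ed.symm (β, (y, s)) = (e.symm (β, y), s) := by
  refine ⟨(Equiv.prodCongr e (Equiv.refl (Fin 2))).trans (Equiv.prodAssoc ι Γ (Fin 2)), fun x s => rfl, fun β y s => ?_⟩
  refine (Equiv.symm_apply_eq _).2 ?_
  show (β, (y, s)) = ((e (e.symm (β, y))).1, ((e (e.symm (β, y))).2, s))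
  rw [Equiv.apply_symm_apply]

end Blocks

section Distances

variable {Λ Λ' : Type*} [DecidableEq Λ]

/-- **The diameter for a pulled-back distance is the diameter of the image**: `diam_{d ∘ f} S = diam_d (f '' S)`. [folklore] -/
theorem labelDiam_comap_image (d : Λ → Λ → ℝ) (f : Λ' → Λ) (S : Finset Λ') :
    labelDiam (fun a b => d (f a) (f b)) S = labelDiam d (S.image f) := by
  refine le_antisymm (labelDiam_le _ (labelDiam_nonneg d _) fun a ha b hb => ?_) (labelDiam_le d (labelDiam_nonneg _ S) fun a' ha' b' hb' => ?_)
  · exact le_labelDiam d (mem_image_of_mem f ha) (mem_image_of_mem f hb)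
  · obtain ⟨a, ha, rfl⟩ := mem_image.1 ha'
    obtain ⟨b, hb, rfl⟩ := mem_image.1 hb'
    exact le_labelDiam (fun a b => d (f a) (f b)) ha hb

/-- **Diameter weights for a pulled-back distance**: `wt_{φ, d ∘ f} S = wt_{φ, d} (f '' S)`. [folklore] -/
theorem diamWeight_comap_eq (φ : ℝ → ℝ) (d : Λ → Λ → ℝ) (f : Λ' → Λ) (S : Finset Λ') :
    diamWeight φ (fun a b => d (f a) (f b)) S = diamWeight φ d (S.image f) := by
  rw [diamWeight, diamWeight, labelDiam_comap_image]

/-- In particular for a string `Y` of doubled labels: `wt_{φ, d ∘ fst} (im Y) = wt_{φ, d} (im (fst ∘ Y))`. [folklore] -/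
theorem diamWeight_comap_image_comp [DecidableEq Λ'] {m : ℕ} (φ : ℝ → ℝ) (d : Λ → Λ → ℝ) (f : Λ' → Λ) (Y : Fin m → Λ') :
    diamWeight φ (fun a b => d (f a) (f b)) (univ.image Y) = diamWeight φ d (univ.image (f ∘ Y)) := by
  rw [diamWeight_comap_eq, image_image]

end Distances

/-! ## §2 Spectator covariances: periodisation, block copies, defects, Gram families, filtered weighted sums -/

section Spectator

variable {𝕜 : Type*} [RCLike 𝕜] {ι : Type*} {Γ Γ' : Type u}

/-- **(P) lifts**: if the fine covariance periodises onto the coarse one over the blocks of `e`, so does its spectator over the doubled blocks.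
[folklore] -/
theorem spectatorCov_periodise [Fintype Γ'] [DecidableEq Γ] (e : Γ' ≃ ι × Γ) (ed : (Γ' × Fin 2) ≃ ι × (Γ × Fin 2)) (hed : ∀ x s, ed (x, s) = ((e x).1, ((e x).2, s)))
    (C : Matrix Γ Γ 𝕜) (C' : Matrix Γ' Γ' 𝕜) (Cd : Matrix (Γ × Fin 2) (Γ × Fin 2) 𝕜) (Cd' : Matrix (Γ' × Fin 2) (Γ' × Fin 2) 𝕜)
    (hCd : ∀ p q, Cd p q = if p.2 = 0 ∧ q.2 = 0 then C p.1 q.1 else 0) (hCd' : ∀ p q, Cd' p q = if p.2 = 0 ∧ q.2 = 0 then C' p.1 q.1 else 0)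
    (hP : ∀ (X' : Γ') (Y : Γ), ∑ Y'' ∈ univ.filter (fun Y'' : Γ' => (e Y'').2 = Y), C' X' Y'' = C (e X').2 Y)
    (X' : Γ' × Fin 2) (Y : Γ × Fin 2) :
    ∑ Y'' ∈ univ.filter (fun Y'' : Γ' × Fin 2 => (ed Y'').2 = Y), Cd' X' Y'' = Cd (ed X').2 Y := by
  obtain ⟨x', s⟩ := X'
  obtain ⟨y, t⟩ := Y
  have hfilter : univ.filter (fun Y'' : Γ' × Fin 2 => (ed Y'').2 = (y, t)) =
      (univ.filter (fun Y'' : Γ' => (e Y'').2 = y)) ×ˢ ({t} : Finset (Fin 2)) := by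
    ext ⟨y'', t'⟩
    simp only [mem_filter, mem_univ, true_and, mem_product, mem_singleton, hed, Prod.mk.injEq]
  rw [hfilter, sum_product, hed]
  simp only [sum_singleton, hCd', hCd]
  by_cases hs : s = 0
  · by_cases ht : t = 0
    · simp only [hs, ht, and_self, if_true]
      exact hP x' y
    · simp only [ht, and_false, if_false, sum_const_zero]
  · simp only [hs, false_and, if_false, sum_const_zero]

/-- **Block copies lift**: the spectator of the block-copied coarse covariance is the block copy of the coarse spectator over the doubled blocks. [folklore] -/
theorem spectatorCov_copies [DecidableEq ι] (e : Γ' ≃ ι × Γ) (ed : (Γ' × Fin 2) ≃ ι × (Γ × Fin 2)) (hed : ∀ x s, ed (x, s) = ((e x).1, ((e x).2, s)))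
    (C : Matrix Γ Γ 𝕜) (Ccop : Matrix Γ' Γ' 𝕜) (Cd : Matrix (Γ × Fin 2) (Γ × Fin 2) 𝕜) (Ccopd : Matrix (Γ' × Fin 2) (Γ' × Fin 2) 𝕜)
    (hCd : ∀ p q, Cd p q = if p.2 = 0 ∧ q.2 = 0 then C p.1 q.1 else 0)
    (hCcopd : ∀ p q, Ccopd p q = if p.2 = 0 ∧ q.2 = 0 then Ccop p.1 q.1 else 0)
    (hCcop : ∀ X' Y', Ccop X' Y' = if (e X').1 = (e Y').1 then C (e X').2 (e Y').2 else 0) (X' Y' : Γ' × Fin 2) :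
    Ccopd X' Y' = if (ed X').1 = (ed Y').1 then Cd (ed X').2 (ed Y').2 else 0 := by
  obtain ⟨x', s⟩ := X'
  obtain ⟨y', t⟩ := Y'
  simp only [hCcopd, hCcop, hed, hCd]
  by_cases hst : s = 0 ∧ t = 0
  · simp only [hst, and_self, if_true]
  · rw [if_neg hst]
    split_ifs <;> rfl

/-- **The far defect lifts** (zone `{p | p.1 ∈ Zs}`). [folklore] -/
theorem spectatorCov_farDefect (C' Ccop Df : Matrix Γ' Γ' 𝕜) (Cd' Ccopd Dfd : Matrix (Γ' × Fin 2) (Γ' × Fin 2) 𝕜) (Zs : Set Γ') [DecidablePred (· ∈ Zs)]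
    (hCd' : ∀ p q, Cd' p q = if p.2 = 0 ∧ q.2 = 0 then C' p.1 q.1 else 0)
    (hCcopd : ∀ p q, Ccopd p q = if p.2 = 0 ∧ q.2 = 0 then Ccop p.1 q.1 else 0)
    (hDfd : ∀ p q, Dfd p q = if p.2 = 0 ∧ q.2 = 0 then Df p.1 q.1 else 0)
    (hDf : ∀ X' Y', Df X' Y' = if X' ∈ Zs ∧ Y' ∈ Zs then C' X' Y' - Ccop X' Y' else 0) (X' Y' : Γ' × Fin 2) :
    Dfd X' Y' = if X'.1 ∈ Zs ∧ Y'.1 ∈ Zs then Cd' X' Y' - Ccopd X' Y' else 0 := by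
  rw [hDfd, hCd', hCcopd]
  by_cases h0 : X'.2 = 0 ∧ Y'.2 = 0
  · simp only [h0, and_self, if_true, hDf]
  · simp only [if_neg h0, sub_zero, ite_self]

/-- **The near defect lifts** (zone `{p | p.1 ∈ Zs}`). [folklore] -/
theorem spectatorCov_nearDefect (C' Ccop Dn : Matrix Γ' Γ' 𝕜) (Cd' Ccopd Dnd : Matrix (Γ' × Fin 2) (Γ' × Fin 2) 𝕜) (Zs : Set Γ') [DecidablePred (· ∈ Zs)]
    (hCd' : ∀ p q, Cd' p q = if p.2 = 0 ∧ q.2 = 0 then C' p.1 q.1 else 0)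
    (hCcopd : ∀ p q, Ccopd p q = if p.2 = 0 ∧ q.2 = 0 then Ccop p.1 q.1 else 0)
    (hDnd : ∀ p q, Dnd p q = if p.2 = 0 ∧ q.2 = 0 then Dn p.1 q.1 else 0)
    (hDn : ∀ X' Y', Dn X' Y' = if X' ∈ Zs ∧ Y' ∈ Zs then 0 else C' X' Y' - Ccop X' Y') (X' Y' : Γ' × Fin 2) :
    Dnd X' Y' = if X'.1 ∈ Zs ∧ Y'.1 ∈ Zs then 0 else Cd' X' Y' - Ccopd X' Y' := by
  rw [hDnd, hCd', hCcopd]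
  by_cases h0 : X'.2 = 0 ∧ Y'.2 = 0
  · simp only [h0, and_self, if_true, hDn]
  · simp only [if_neg h0, sub_zero, ite_self]

/-- Scalar multiples of spectators are spectators of scalar multiples. [folklore] -/
theorem spectatorCov_smul (D : Matrix Γ' Γ' 𝕜) (Dd : Matrix (Γ' × Fin 2) (Γ' × Fin 2) 𝕜)
    (hDd : ∀ p q, Dd p q = if p.2 = 0 ∧ q.2 = 0 then D p.1 q.1 else 0) (t : ℝ) (p q : Γ' × Fin 2) :
    (t • Dd) p q = if p.2 = 0 ∧ q.2 = 0 then (t • D) p.1 q.1 else 0 := by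
  simp only [Matrix.smul_apply, hDd, smul_ite, smul_zero]

/-- Interpolated families `D_f + t • D_n` of spectators are spectators of the interpolated families. [folklore] -/
theorem spectatorCov_add_smul (Df Dn : Matrix Γ' Γ' 𝕜) (Dfd Dnd : Matrix (Γ' × Fin 2) (Γ' × Fin 2) 𝕜)
    (hDfd : ∀ p q, Dfd p q = if p.2 = 0 ∧ q.2 = 0 then Df p.1 q.1 else 0) (hDnd : ∀ p q, Dnd p q = if p.2 = 0 ∧ q.2 = 0 then Dn p.1 q.1 else 0)
    (t : ℝ) (p q : Γ' × Fin 2) :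
    (Dfd + t • Dnd) p q = if p.2 = 0 ∧ q.2 = 0 then (Df + t • Dn) p.1 q.1 else 0 := by
  simp only [Matrix.add_apply, Matrix.smul_apply, hDfd, hDnd]
  split_ifs <;> simp

/-- **Replica-Gram constants of the scaled far defects lift**: `(∀ t ∈ [0,1], IsGramBoundedR (t • Df) κ) ⇒ (∀ t ∈ [0,1], IsGramBoundedR (t • Df⁺) κ)`.
[folklore] -/
theorem isGramBoundedR_spectator_smul [Fintype Γ'] [DecidableEq Γ'] (Df : Matrix Γ' Γ' 𝕜) (Dfd : Matrix (Γ' × Fin 2) (Γ' × Fin 2) 𝕜)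
    (hDfd : ∀ p q, Dfd p q = if p.2 = 0 ∧ q.2 = 0 then Df p.1 q.1 else 0) {κ : ℝ}
    (h : ∀ t ∈ Set.Icc (0 : ℝ) 1, IsGramBoundedR (t • Df) κ) : ∀ t ∈ Set.Icc (0 : ℝ) 1, IsGramBoundedR (t • Dfd) κ :=
  fun t ht => isGramBoundedR_spectator (t • Df) (t • Dfd) (spectatorCov_smul Df Dfd hDfd t) (h t ht)

/-- **Replica-Gram constants of the interpolated defects lift**: `(∀ t ∈ [0,1], IsGramBoundedR (Df + t • Dn) κ) ⇒ (∀ t ∈ [0,1], IsGramBoundedR (Df⁺ + t • Dn⁺) κ)`.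
[folklore] -/
theorem isGramBoundedR_spectator_add_smul [Fintype Γ'] [DecidableEq Γ'] (Df Dn : Matrix Γ' Γ' 𝕜) (Dfd Dnd : Matrix (Γ' × Fin 2) (Γ' × Fin 2) 𝕜)
    (hDfd : ∀ p q, Dfd p q = if p.2 = 0 ∧ q.2 = 0 then Df p.1 q.1 else 0) (hDnd : ∀ p q, Dnd p q = if p.2 = 0 ∧ q.2 = 0 then Dn p.1 q.1 else 0)
    {κ : ℝ} (h : ∀ t ∈ Set.Icc (0 : ℝ) 1, IsGramBoundedR (Df + t • Dn) κ) :
    ∀ t ∈ Set.Icc (0 : ℝ) 1, IsGramBoundedR (Dfd + t • Dnd) κ :=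
  fun t ht => isGramBoundedR_spectator (Df + t • Dn) (Dfd + t • Dnd) (spectatorCov_add_smul Df Dn Dfd Dnd hDfd hDnd t) (h t ht)

/-- **Master formula, rows**: a filtered, weighted row sum of a spectator at an alive row is the corresponding alive row sum over the copy-`0` labels; at a
source row it vanishes. [folklore] -/
theorem sum_filter_norm_spectatorCov_mul_row {Γ₁ Γ₂ : Type*} [Fintype Γ₂] (C : Matrix Γ₁ Γ₂ 𝕜) (Cd : Matrix (Γ₁ × Fin 2) (Γ₂ × Fin 2) 𝕜)
    (hCd : ∀ p q, Cd p q = if p.2 = 0 ∧ q.2 = 0 then C p.1 q.1 else 0) (Q : Γ₂ × Fin 2 → Prop) [DecidablePred Q]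
    (g : Γ₂ × Fin 2 → ℝ) (p : Γ₁ × Fin 2) :
    ∑ q ∈ univ.filter Q, ‖Cd p q‖ * g q =
      if p.2 = 0 then ∑ y ∈ univ.filter (fun y : Γ₂ => Q (y, 0)), ‖C p.1 y‖ * g (y, 0) else 0 := by
  classical
  rw [sum_filter, Fintype.sum_prod_type, sum_filter]
  by_cases hp : p.2 = 0
  · rw [if_pos hp]
    refine sum_congr rfl fun y _ => ?_
    rw [Fin.sum_univ_two, hCd, hCd]
    simp only [hp, true_and, if_true, Fin.isValue, one_ne_zero, if_false, norm_zero, zero_mul, ite_self, add_zero]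
  · rw [if_neg hp]
    refine sum_eq_zero fun y _ => sum_eq_zero fun s _ => ?_
    have h0 : Cd p (y, s) = 0 := by rw [hCd, if_neg (fun h => hp h.1)]
    rw [h0, norm_zero, zero_mul, ite_self]

/-- **Master formula, columns**. [folklore] -/
theorem sum_filter_norm_spectatorCov_mul_col {Γ₁ Γ₂ : Type*} [Fintype Γ₁] (C : Matrix Γ₁ Γ₂ 𝕜) (Cd : Matrix (Γ₁ × Fin 2) (Γ₂ × Fin 2) 𝕜)
    (hCd : ∀ p q, Cd p q = if p.2 = 0 ∧ q.2 = 0 then C p.1 q.1 else 0) (Q : Γ₁ × Fin 2 → Prop) [DecidablePred Q]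
    (g : Γ₁ × Fin 2 → ℝ) (q : Γ₂ × Fin 2) :
    ∑ p ∈ univ.filter Q, ‖Cd p q‖ * g p =
      if q.2 = 0 then ∑ x ∈ univ.filter (fun x : Γ₁ => Q (x, 0)), ‖C x q.1‖ * g (x, 0) else 0 := by
  classical
  rw [sum_filter, Fintype.sum_prod_type, sum_filter]
  by_cases hq : q.2 = 0
  · rw [if_pos hq]
    refine sum_congr rfl fun x _ => ?_
    rw [Fin.sum_univ_two, hCd, hCd]
    simp only [hq, and_true, if_true, Fin.isValue, one_ne_zero, if_false, norm_zero, zero_mul, ite_self, add_zero]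
  · rw [if_neg hq]
    refine sum_eq_zero fun x _ => sum_eq_zero fun s _ => ?_
    have h0 : Cd (x, s) q = 0 := by rw [hCd, if_neg (fun h => hq h.2)]
    rw [h0, norm_zero, zero_mul, ite_self]

/-- **Filtered weighted row sums are bounded by the alive ones** (`0 ≤ a`). [folklore] -/
theorem sum_filter_norm_spectatorCov_mul_row_le {Γ₁ Γ₂ : Type*} [Fintype Γ₂] (C : Matrix Γ₁ Γ₂ 𝕜) (Cd : Matrix (Γ₁ × Fin 2) (Γ₂ × Fin 2) 𝕜)
    (hCd : ∀ p q, Cd p q = if p.2 = 0 ∧ q.2 = 0 then C p.1 q.1 else 0) (Q : Γ₂ × Fin 2 → Prop) [DecidablePred Q]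
    (g : Γ₂ × Fin 2 → ℝ) (p : Γ₁ × Fin 2) {a : ℝ} (ha : 0 ≤ a)
    (h : ∑ y ∈ univ.filter (fun y : Γ₂ => Q (y, 0)), ‖C p.1 y‖ * g (y, 0) ≤ a) :
    ∑ q ∈ univ.filter Q, ‖Cd p q‖ * g q ≤ a := by
  rw [sum_filter_norm_spectatorCov_mul_row C Cd hCd Q g p]
  split_ifs
  · exact h
  · exact ha

/-- **Filtered weighted column sums are bounded by the alive ones** (`0 ≤ a`). [folklore] -/
theorem sum_filter_norm_spectatorCov_mul_col_le {Γ₁ Γ₂ : Type*} [Fintype Γ₁] (C : Matrix Γ₁ Γ₂ 𝕜) (Cd : Matrix (Γ₁ × Fin 2) (Γ₂ × Fin 2) 𝕜)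
    (hCd : ∀ p q, Cd p q = if p.2 = 0 ∧ q.2 = 0 then C p.1 q.1 else 0) (Q : Γ₁ × Fin 2 → Prop) [DecidablePred Q]
    (g : Γ₁ × Fin 2 → ℝ) (q : Γ₂ × Fin 2) {a : ℝ} (ha : 0 ≤ a)
    (h : ∑ x ∈ univ.filter (fun x : Γ₁ => Q (x, 0)), ‖C x q.1‖ * g (x, 0) ≤ a) :
    ∑ p ∈ univ.filter Q, ‖Cd p q‖ * g p ≤ a := by
  rw [sum_filter_norm_spectatorCov_mul_col C Cd hCd Q g q]
  split_ifs
  · exact h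
  · exact ha

/-- **Unfiltered weighted row sums** (the first-moment / `diamWeight`-row hypotheses): `Σ_q ‖C⁺ p q‖·g q ≤ a` from `Σ_y ‖C p.1 y‖·g (y,0) ≤ a`. [folklore] -/
theorem sum_norm_spectatorCov_mul_row_le {Γ₁ Γ₂ : Type*} [Fintype Γ₂] (C : Matrix Γ₁ Γ₂ 𝕜) (Cd : Matrix (Γ₁ × Fin 2) (Γ₂ × Fin 2) 𝕜)
    (hCd : ∀ p q, Cd p q = if p.2 = 0 ∧ q.2 = 0 then C p.1 q.1 else 0) (g : Γ₂ × Fin 2 → ℝ) (p : Γ₁ × Fin 2) {a : ℝ} (ha : 0 ≤ a)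
    (h : ∑ y, ‖C p.1 y‖ * g (y, 0) ≤ a) : ∑ q, ‖Cd p q‖ * g q ≤ a := by
  classical
  have h' := sum_filter_norm_spectatorCov_mul_row_le C Cd hCd (fun _ => True) g p ha (by rw [filter_true_of_mem fun _ _ => trivial]; exact h)
  rwa [filter_true_of_mem fun _ _ => trivial] at h'

/-- **Unfiltered weighted column sums**. [folklore] -/
theorem sum_norm_spectatorCov_mul_col_le {Γ₁ Γ₂ : Type*} [Fintype Γ₁] (C : Matrix Γ₁ Γ₂ 𝕜) (Cd : Matrix (Γ₁ × Fin 2) (Γ₂ × Fin 2) 𝕜)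
    (hCd : ∀ p q, Cd p q = if p.2 = 0 ∧ q.2 = 0 then C p.1 q.1 else 0) (g : Γ₁ × Fin 2 → ℝ) (q : Γ₂ × Fin 2) {a : ℝ} (ha : 0 ≤ a)
    (h : ∑ x, ‖C x q.1‖ * g (x, 0) ≤ a) : ∑ p, ‖Cd p q‖ * g p ≤ a := by
  classical
  have h' := sum_filter_norm_spectatorCov_mul_col_le C Cd hCd (fun _ => True) g q ha (by rw [filter_true_of_mem fun _ _ => trivial]; exact h)
  rwa [filter_true_of_mem fun _ _ => trivial] at h'

/-- **Pair weights for the pulled-back distance**: `wt_{φ, d ∘ fst} {p, q} = wt_{φ, d} {p.1, q.1}` (label distances). [folklore] -/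
theorem diamWeight_pair_comap_fst {Λ : Type*} [DecidableEq Λ] {φ : ℝ → ℝ} {d : Λ → Λ → ℝ} (hd : IsLabelDist d) (p q : Λ × Fin 2) :
    diamWeight φ (fun a b : Λ × Fin 2 => d a.1 b.1) {p, q} = diamWeight φ d {p.1, q.1} := by
  rw [diamWeight_pair (hd.comap Prod.fst), diamWeight_pair hd]

end Spectator

end Summit.HubbardSuperconductivity.HubbardSuperconductivity.Theorems.TwoVolumeDefect

end
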